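import Mathlib
import Summits.MatrixMultiplication.MatrixMultiplication.Theses.LevelGradedCohnUmans
import Summits.MatrixMultiplication.MatrixMultiplication.Theses.GroupTheoreticSTPP
import Literature.RepresentationTheory.FiniteGroups.IrreducibleCharacters
import Literature.RepresentationTheory.FiniteGroups.WedderburnBlocks
import Literature.RepresentationTheory.FiniteGroups.NonabelianCharDegree

/-!
# The full-budget link: `CNonabelianTPPFamilies ⇒ GradedDesignFamily` (at `J = ⊤`)

Route `LevelGradedCohnUmans`, crux `GradedDesignFamily` (stmt-MatrixMultiplication-7610), line
`quadratic-extension-level-one-cell`; helper banked for the strategist census (F9).  The sibling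
route's crux `GroupTheoreticSTPP.CNonabelianTPPFamilies` supplies, for every `δ > 0` and `n₀`, a
finite group `G` and a TPP triple `S, T, U` (Cohn–Umans one-relation form) of volume
`V = |S||T||U| ≥ n₀` with `|G| ≤ V^{(2+δ)/3}` and `d_max(G) ≤ V^{δ/3}`.  Taking the FULL test space
`J = ⊤ = ℂ^G` (trivially bi-invariant), the indicator of `x₀⁻¹ z₀` separates the target `(x₀, z₀)`
(this is exactly the TPP), and the graded budget is the whole character-degree power sum
`Σ_χ χ(1)^{2+ε} ≤ d_max^ε · Σ_χ χ(1)² = d_max^ε · |G| ≤ V^{(2+δ+δε)/3} < V^{(2+ε)/3}` as soon as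
`δ(1+ε) < ε` and `V ≥ 2`.

* `fullBudget_sep` — TPP ⇒ `⊤`-separation by indicators;
* `fullBudget_le` — `Σ_{χ ∈ Irr G} χ(1)^{2+ε} ≤ d_max(G)^ε · |G|` (`sum_sq_charDegrees_holds`);
* `gradedDesignFamily_of_nonabelianTPPFamilies` — the registered stub.
-/

noncomputable section

set_option linter.dupNamespace false

open scoped BigOperators
open Literature.RepresentationTheory.FiniteGroups
open Summit.MatrixMultiplication.MatrixMultiplication.Theses.LevelGradedCohnUmans
open Summit.MatrixMultiplication.MatrixMultiplication.Theses.GroupTheoreticSTPP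

namespace Summit.MatrixMultiplication.MatrixMultiplication.Theorems.GradedDesignFamily

/-- **TPP ⇒ full-budget separation**: if `S, T, U` satisfy the triple product property in the
one-relation form `s s'⁻¹ · t t'⁻¹ · u u'⁻¹ = 1 ⇒ s = s', t = t', u = u'`, then for every target
`(x₀, z₀)` the indicator function of `x₀⁻¹ z₀` (a member of `⊤ = ℂ^G`) takes the value `1` on the
words `x⁻¹ y y'⁻¹ z` with `x = x₀, y = y', z = z₀` and `0` on all other words of `S⁻¹ T T⁻¹ U`.
[cite: CohnUmans2003, Def. 2.1] -/
theorem fullBudget_sep {G : Type} [Group G] (S T U : Finset G)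
    (htpp : ∀ s ∈ S, ∀ s' ∈ S, ∀ t ∈ T, ∀ t' ∈ T, ∀ u ∈ U, ∀ u' ∈ U,
      (s * s'⁻¹) * (t * t'⁻¹) * (u * u'⁻¹) = 1 → s = s' ∧ t = t' ∧ u = u') :
    ∀ x₀ ∈ S, ∀ z₀ ∈ U, ∃ f ∈ (⊤ : Submodule ℂ (G → ℂ)), ∀ x ∈ S, ∀ y ∈ T, ∀ y' ∈ T, ∀ z ∈ U,
      (x = x₀ ∧ y = y' ∧ z = z₀ → f (x⁻¹ * y * y'⁻¹ * z) = 1) ∧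
      (¬ (x = x₀ ∧ y = y' ∧ z = z₀) → f (x⁻¹ * y * y'⁻¹ * z) = 0) := by
  classical
  intro x₀ hx₀ z₀ hz₀
  refine ⟨fun g => if g = x₀⁻¹ * z₀ then (1 : ℂ) else 0, Submodule.mem_top, ?_⟩
  intro x hx y hy y' hy' z hz
  refine ⟨?_, fun hne => ?_⟩
  · rintro ⟨rfl, rfl, rfl⟩
    simp
  · beta_reduce
    rw [if_neg]
    intro heq
    apply hne
    have key : (x₀ * x⁻¹) * (y * y'⁻¹) * (z * z₀⁻¹) = 1 := by
      calc (x₀ * x⁻¹) * (y * y'⁻¹) * (z * z₀⁻¹) = x₀ * (x⁻¹ * y * y'⁻¹ * z) * z₀⁻¹ := by group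
        _ = x₀ * (x₀⁻¹ * z₀) * z₀⁻¹ := by rw [heq]
        _ = 1 := by group
    obtain ⟨h1, h2, h3⟩ := htpp x₀ hx₀ x hx y hy y' hy' z hz z₀ hz₀ key
    exact ⟨h1.symm, h2, h3⟩

/-- **The full graded budget**: at `J = ⊤` the graded budget is the whole character-degree power
sum, and `Σ_{χ ∈ Irr G} χ(1)^{2+ε} ≤ d_max(G)^ε · Σ_χ χ(1)² = d_max(G)^ε · |G|` (termwise
`1 ≤ χ(1) ≤ d_max`, then `Σ_χ χ(1)² = |G|`, the tree's `sum_sq_charDegrees_holds`).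
[cite: CohnUmans2003, §1.3] -/
theorem fullBudget_le {G : Type} [Group G] [Fintype G] {ε : ℝ} (hε : 0 ≤ ε) :
    (∑ᶠ χ ∈ irrChars G ∩ ((⊤ : Submodule ℂ (G → ℂ)) : Set (G → ℂ)), (χ 1).re ^ (2 + ε)) ≤
      (maxCharDegree G : ℝ) ^ ε * (Fintype.card G : ℝ) := by
  classical
  have hfin : (irrChars G).Finite := irrChars_finite_holds G
  -- `|G| = Σ_χ χ(1)²`, moved to `ℝ`
  have hsq : ∑ χ ∈ hfin.toFinset, (χ 1).re ^ (2 : ℝ) = (Fintype.card G : ℝ) := by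
    have h := sum_sq_charDegrees_holds G
    rw [finsum_mem_eq_finite_toFinset_sum _ hfin] at h
    have h' := congrArg Complex.re h
    rw [Complex.re_sum, Complex.natCast_re, Nat.card_eq_fintype_card] at h'
    rw [← h']
    refine Finset.sum_congr rfl fun χ hχ => ?_
    obtain ⟨d, -, hd⟩ := IsIrrChar.exists_apply_one (hfin.mem_toFinset.1 hχ)
    rw [hd, Real.rpow_two, ← Nat.cast_pow, Complex.natCast_re, Complex.natCast_re, Nat.cast_pow]
  rw [Submodule.top_coe, Set.inter_univ, finsum_mem_eq_finite_toFinset_sum _ hfin, ← hsq,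
    Finset.mul_sum]
  refine Finset.sum_le_sum fun χ hχ => ?_
  obtain ⟨d, hdmem, hd⟩ := IsIrrChar.exists_apply_one (hfin.mem_toFinset.1 hχ)
  have hre : (χ 1).re = d := by rw [hd, Complex.natCast_re]
  have h1 : (1 : ℝ) ≤ (χ 1).re := by
    rw [hre]
    exact_mod_cast pos_of_mem_charDegrees hdmem
  have hle : (χ 1).re ≤ maxCharDegree G := by
    rw [hre]
    exact_mod_cast le_maxCharDegree (bddAbove_charDegrees' G) hdmem
  have h0 : 0 < (χ 1).re := one_pos.trans_le h1
  calc (χ 1).re ^ (2 + ε) = (χ 1).re ^ ε * (χ 1).re ^ (2 : ℝ) := by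
        rw [add_comm, Real.rpow_add h0]
    _ ≤ (maxCharDegree G : ℝ) ^ ε * (χ 1).re ^ (2 : ℝ) :=
        mul_le_mul_of_nonneg_right (Real.rpow_le_rpow h0.le hle hε) (Real.rpow_nonneg h0.le _)

/-- **The full-budget link** (strategist census F9): the sibling route's crux
`CNonabelianTPPFamilies` — TPP triples of volume `V → ∞` with `|G| ≤ V^{(2+δ)/3}` and
`d_max(G) ≤ V^{δ/3}` for every `δ > 0` — implies `GradedDesignFamily` with the full test space
`J = ⊤`: given `ε > 0` call the hypothesis with `δ = ε / (2(1+ε))` (so `δ(1+ε) < ε`) and `n₀ = 2`;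
then `⊤` is bi-invariant, the TPP triple is `⊤`-separated (`fullBudget_sep`), and the graded budget
is `≤ d_max^ε |G| ≤ V^{(2+δ+δε)/3} < V^{(2+ε)/3}` (`fullBudget_le`, `V ≥ 2`).
[cite: CohnKleinbergSzegedyUmans2005, Cor. 1.9] -/
theorem gradedDesignFamily_of_nonabelianTPPFamilies
    (h : Summit.MatrixMultiplication.MatrixMultiplication.Theses.GroupTheoreticSTPP.CNonabelianTPPFamilies) :
    Summit.MatrixMultiplication.MatrixMultiplication.Theses.LevelGradedCohnUmans.GradedDesignFamily := by
  intro ε hε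
  -- the auxiliary exponent `δ` with `δ (1 + ε) < ε`
  set δ : ℝ := ε / (2 * (1 + ε)) with hδ_def
  have h1ε : (0 : ℝ) < 1 + ε := by linarith
  have hδ : 0 < δ := by rw [hδ_def]; positivity
  have hδε : δ + δ * ε < ε := by
    have hmul : δ * (2 * (1 + ε)) = ε := by
      rw [hδ_def]; field_simp
    nlinarith
  obtain ⟨G, instG, instF, S, T, U, htpp, hn0, hG, hd⟩ := h δ hδ 2
  refine ⟨G, instG, instF, ⊤, S, T, U, fun f _ a b => Submodule.mem_top,
    fullBudget_sep S T U htpp, ?_⟩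
  have hV0 : (0 : ℝ) ≤ ((S.card * T.card * U.card : ℕ) : ℝ) := Nat.cast_nonneg _
  have hV1 : (1 : ℝ) < ((S.card * T.card * U.card : ℕ) : ℝ) := by
    have h2 : (2 : ℝ) ≤ ((S.card * T.card * U.card : ℕ) : ℝ) := by exact_mod_cast hn0
    linarith
  have hVpos : (0 : ℝ) < ((S.card * T.card * U.card : ℕ) : ℝ) := one_pos.trans hV1
  calc (∑ᶠ χ ∈ irrChars G ∩ ((⊤ : Submodule ℂ (G → ℂ)) : Set (G → ℂ)), (χ 1).re ^ (2 + ε))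
      ≤ (maxCharDegree G : ℝ) ^ ε * (Fintype.card G : ℝ) := fullBudget_le hε.le
    _ ≤ (((S.card * T.card * U.card : ℕ) : ℝ) ^ (δ / 3)) ^ ε *
          ((S.card * T.card * U.card : ℕ) : ℝ) ^ ((2 + δ) / 3) :=
        mul_le_mul (Real.rpow_le_rpow (Nat.cast_nonneg _) hd hε.le) hG (Nat.cast_nonneg _)
          (Real.rpow_nonneg (Real.rpow_nonneg hV0 _) _)
    _ = ((S.card * T.card * U.card : ℕ) : ℝ) ^ ((2 + δ + δ * ε) / 3) := by
        rw [← Real.rpow_mul hV0, ← Real.rpow_add hVpos]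
        ring_nf
    _ < ((S.card * T.card * U.card : ℕ) : ℝ) ^ ((2 + ε) / 3) :=
        Real.rpow_lt_rpow_of_exponent_lt hV1 (by linarith)

end Summit.MatrixMultiplication.MatrixMultiplication.Theorems.GradedDesignFamily

end
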